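import Literature.NumberTheory.EllipticCurves.BSDSelmerPConverseRationalHeegnerDescentProofs
import Literature.NumberTheory.EllipticCurves.HeegnerModuleIndex
import HarnessLib

/-!
# The Heegner-module index vanishes under the rational Heegner point main conjecture in corank one

Sibling proof file (theorems only, no named fact, D-0014/D-0026) in the story of the named fact
`Literature.NumberTheory.EllipticCurves.yanZhu_analyticRank_eq_one_of_selmerCorank_eq_one`
(X. Yan, X. Zhu, arXiv:2412.20078 = J. Algebra (2026), Cor. 1.4 = Thm. 4.15). It runs the
module-theoretic skeleton of Yan–Zhu's descent sentence (proof of Thm. 4.15, §4.6: "by applying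
descent arguments to (the rational part of) Theorem 4.12 (2) and using Gross-Zagier formula, we have
`corank_{ℤ_p} Sel_{p^∞}(E/K) = 1` implies `ord_{s=1} L(E/K, s) = 1`";
`Literature.NumberTheory.EllipticCurves.BSDSelmerPConverseRationalHeegnerDescentProofs`) on the
tree's OWN anticyclotomic objects (`Literature.NumberTheory.EllipticCurves.HeegnerModuleIndex`):
the `Λ`-adic Selmer datum `D : LambdaAdicSelmerData` (`S = 𝔖_p(K_∞) = H¹_{F_Λ}(K, 𝐓)`), a Heegner
family `F` with its Heegner module `ℋ_∞ = heegnerModule D F ⊆ D.S` (Howard's `𝐇`, Perrin-Riou's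
`ℋ_∞`), Perrin-Riou's `I(ℋ_∞) = heegnerCharIdeal D F = char_Λ(S/ℋ_∞)` (Howard's `𝐋`), the
Heegner-module index `a(E, K, p) = heegnerModuleIndex D F = ord_J I(ℋ_∞)` (`J = (γ - 1) = (T)`),
and an Iwasawa-module datum `X : SelmerDualData` for `𝒳 = Sel_{p^∞}(E/K_∞)^∨`.

## What is proved

Taking as hypotheses the two tree facts of Howard 2004 (Compositio 140, Thm. B and Thm. 3.3.7, as
vendored: `Howard2004_thmB`, `Howard2004_heegnerModule_free`) under Howard's standing hypotheses
`HowardHypotheses`, together with the two inputs of the sentence that the tree does not yet state —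

* `hMC`, **the rational Heegner point main conjecture in the direction opposite to Howard's (c)**:
  `c · char_Λ(𝒳_{Λ-tors}) ⊆ I(ℋ_∞)²` for some nonzero constant `c ∈ ℤ_p`
  ("`Char(𝒳_ord(E/K_∞^-)_tor) ⊗ ℚ_p = Char(S_ord(E/K_∞^-)/Λ_K^- · κ)² ⊗ ℚ_p`", Yan–Zhu Thm. 4.12 (2);
  Howard's (c) is the containment `I(ℋ_∞)² ⊆ char(𝒳_tors)` and is part of `Howard2004_thmB`);
* `hctl`, **`rank_{ℤ_p} 𝒳/J𝒳 ≤ 1`**: Mazur's control theorem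
  "`rank_{ℤ_p} X/(γ - 1)X = corank_{ℤ_p} Sel_{p^∞}(E/K)`" (Howard 2004, §1, before eq. (2)) combined
  with the corank-one hypothesis `corank_{ℤ_p} Sel_{p^∞}(E/K) = 1` —

the file proves:

* `heegnerModuleIndex_eq_zero_of_rational_mainConjecture` — **`a(E, K, p) = ord_J I(ℋ_∞) = 0`**:
  the `Λ`-adic Heegner class is `J`-indivisible up to `ℤ_p`-torsion. (By contrast Howard's own
  inequality `corank ≤ 1 + 2 · ord_J I(ℋ_∞)`, tree fact `Howard2004_selmerCorank_le`, bounds the corank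
  by the index; the `p`-converse goes the other way and needs the opposite divisibility `hMC`.)
* `exists_heegnerModule_eq_span_singleton` — `ℋ_∞ = Λ κ_∞` for some `κ_∞ ≠ 0` (from
  `Howard2004_heegnerModule_free`), and
  `pow_smul_heegnerGenerator_notMem_TSubmodule` — for every such generator,
  **`p^m κ_∞ ∉ (γ - 1) S` for all `m`**: the image of `κ_∞` in `S_Γ = S/JS` is not `ℤ_p`-torsion
  ("the image `κ₁` of `κ₁^{Hg}` is not torsion", Wan, proof of Thm. 3.17).

What then remains of the sentence is arithmetic and outside this file: the specialisation
`S_Γ ↪ S_p(E/K) ⊗ ℚ_p` carrying `κ_∞` to a nonzero multiple of the Kummer image of the Heegner point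
`y_K` (Howard 2004 §1; Perrin-Riou 1987 §3.4), so that `y_K` is non-torsion, and
Gross–Zagier–Kolyvagin over `K` (tree fact `analyticRankEK_eq_one_iff_heegner_nonTorsion`), giving
`ord_{s=1} L(E/K, s) = 1`.

Scope caveat. `HowardHypotheses` are Howard's (2004): `p ∤ 2 N d_K h_K`, `d_K ∉ {-3, -4}`, the
Heegner hypothesis, `Γ_K ↠ Aut_{ℤ_p}(T_p E)`, `E` good ordinary at `p`; Yan–Zhu's §4.5 setting
(`p > 2` good ordinary split in `K`, Heegner hypothesis, `ρ̄_E|_{G_K}` irreducible) is wider — in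
particular it has no class-number condition — so this file covers their sentence only over Howard's
locus. Nothing is asserted here: the file adds no `def … : Prop`.

## References

* [YanZhu2024MainConjNonCM] X. Yan, X. Zhu, arXiv:2412.20078 = J. Algebra (2026): Thm. 4.12 (2)
  (§4.5, chunk 11 of the held text), Thm. 4.15 and its proof (§4.6, chunk 12).
* [Howard2004HeegnerKolyvagin] B. Howard, *The Heegner point Kolyvagin system*, Compositio Math.
  140 (2004): §1 Thm. B and eq. (2), Thm. 3.3.7.
* [Wan2021HeegnerPointKolyvaginSystem] X. Wan, Acta Math. Sin. (Engl. Ser.) 37 (2021): Thm. 3.17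
  (proof, p. 10 of the held text).
* [PerrinRiou1987BSMF] B. Perrin-Riou, Bull. SMF 115 (1987): §1 p. 405 (`I(ℋ_∞)`, Conj. B), §3.4.
-/

noncomputable section

open scoped Classical

namespace Literature.NumberTheory.EllipticCurves

open WeierstrassCurve IwasawaAlgebra

universe u

variable {N : ℕ} [NeZero N] {W : WeierstrassCurve ℚ} [W.IsGloballyMinimal] {K : Type u} [Field K]
  [NumberField K] {p : ℕ} [Fact p.Prime] {κ : ZpExtension K p} {γ : Field.absoluteGaloisGroup K}
  {jbar : AlgebraicClosure K →+* ℂ}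

omit [W.IsGloballyMinimal] in
/-- The Heegner-module index is the local length of `S/ℋ_∞` at the augmentation prime
`𝔭 = (T) = primeT p` (unfolding; `heegnerModuleIndex_def`). [folklore] -/
theorem heegnerModuleIndex_eq_lengthAt_primeT (D : (W.baseChange K).LambdaAdicSelmerData κ γ)
    (F : HeegnerFamily N W K κ jbar) :
    heegnerModuleIndex D F =
      Module.lengthAt (IwasawaAlgebra p) (D.S ⧸ heegnerModule D F) (primeT p) :=
  rfl

/-- **`S/ℋ_∞` is `Λ`-torsion** under Howard's Thm. B (a) (`S` torsion-free of rank one) and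
Thm. 3.3.7 (`ℋ_∞` free of rank one): rank–nullity over the domain `Λ` (Perrin-Riou 1987, §1 p. 405:
"`I(H_∞)` … est non nul si et seulement si `H_∞` et `𝔖_p(D_∞)` sont de même rang égal à `1`").
[cite: Howard2004HeegnerKolyvagin, §1 Thm. B and Thm. 3.3.7] [cite: PerrinRiou1987BSMF, §1 p. 405] -/
theorem isTorsion_quotient_heegnerModule (hB : Howard2004_thmB N W K p κ γ jbar)
    (hH : Howard2004_heegnerModule_free N W K p κ γ jbar) (hyp : HowardHypotheses N W K p κ γ)
    (D : (W.baseChange K).LambdaAdicSelmerData κ γ) (F : HeegnerFamily N W K κ jbar)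
    (X : (W.baseChange K).SelmerDualData κ γ) :
    Module.IsTorsion (IwasawaAlgebra p) (D.S ⧸ heegnerModule D F) := by
  obtain ⟨⟨hSfin, hStf, hS1⟩, -⟩ := hB hyp D F X
  obtain ⟨-, hH1⟩ := hH hyp D F
  have hS : Module.rank (IwasawaAlgebra p) D.S = 1 := by
    rw [← Module.finrank_eq_rank, hS1, Nat.cast_one]
  have hk : (1 : Cardinal) ≤ Module.rank (IwasawaAlgebra p) (heegnerModule D F) :=
    Cardinal.one_le_iff_ne_zero.mpr fun h0 ↦ by simp [Module.finrank, h0] at hH1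
  have hsum := rank_quotient_add_rank_of_isDomain (heegnerModule D F)
  have hq0 : Module.rank (IwasawaAlgebra p) (D.S ⧸ heegnerModule D F) = 0 := by
    by_contra hne
    have h1 : (1 : Cardinal) ≤ Module.rank (IwasawaAlgebra p) (D.S ⧸ heegnerModule D F) :=
      Cardinal.one_le_iff_ne_zero.mpr hne
    have h2 : (1 : Cardinal) + 1 ≤ Module.rank (IwasawaAlgebra p) D.S := hsum ▸ add_le_add h1 hk
    rw [hS] at h2
    norm_num at h2
  exact rank_eq_zero_iff_isTorsion.mp hq0

/-- **The Heegner-module index vanishes: `a(E, K, p) = ord_J I(ℋ_∞) = 0`** (the Iwasawa-theoretic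
core of Yan–Zhu's proof of Thm. 4.15, (2) ⇒ (3): "by applying descent arguments to (the rational part
of) Theorem 4.12 (2) […] `corank_{ℤ_p} Sel_{p^∞}(E/K) = 1` implies `ord_{s=1} L(E/K, s) = 1`", run as
in Wan 2021, proof of Thm. 3.17, on the tree's objects). Inputs: Howard's Thm. B and Thm. 3.3.7
(`hB`, `hH`: tree facts, taken as hypotheses) under `HowardHypotheses`; the rational Heegner point
main conjecture in the direction opposite to Howard's (c), `c · char(𝒳_{Λ-tors}) ⊆ I(ℋ_∞)²` with
`c ∈ ℤ_p ∖ {0}` (`hMC`); and `rank_{ℤ_p} 𝒳/J𝒳 ≤ 1` (`hctl`: Mazur's control theorem with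
`corank_{ℤ_p} Sel_{p^∞}(E/K) = 1`). Proof: `S/ℋ_∞` is torsion (`isTorsion_quotient_heegnerModule`),
`(𝒳_tors)_Γ` is finite (Step 1 from `rank_Λ 𝒳 = 1`,
`IwasawaAlgebra.finite_coinvariants_torsion_of_finrank_eq_one`), and Step 2 run rationally
(`IwasawaAlgebra.lengthAt_primeT_eq_zero_of_C_mul_charIdeal_le_sq`).
[cite: YanZhu2024MainConjNonCM, Thm. 4.15 (proof, §4.6) with Thm. 4.12 (2) (§4.5)]
[cite: Howard2004HeegnerKolyvagin, §1 Thm. B, eq. (2) and Thm. 3.3.7]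
[cite: Wan2021HeegnerPointKolyvaginSystem, Thm. 3.17 (proof, p. 10)] -/
theorem heegnerModuleIndex_eq_zero_of_rational_mainConjecture
    (hB : Howard2004_thmB N W K p κ γ jbar) (hH : Howard2004_heegnerModule_free N W K p κ γ jbar)
    (hyp : HowardHypotheses N W K p κ γ)
    (D : (W.baseChange K).LambdaAdicSelmerData κ γ) (F : HeegnerFamily N W K κ jbar)
    (X : (W.baseChange K).SelmerDualData κ γ)
    {c : ℤ_[p]} (hc : c ≠ 0)
    (hMC : Ideal.span {(PowerSeries.C c : IwasawaAlgebra p)} *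
        Module.charIdeal (IwasawaAlgebra p) (Submodule.torsion (IwasawaAlgebra p) X.X) ≤
      heegnerCharIdeal D F ^ 2)
    (hctl : coinvariantsRank p X.X ≤ 1) :
    heegnerModuleIndex D F = 0 := by
  obtain ⟨⟨hSfin, hStf, hS1⟩, ⟨hXfin, hX1, -⟩⟩ := hB hyp D F X
  rw [heegnerModuleIndex_eq_lengthAt_primeT]
  exact lengthAt_primeT_eq_zero_of_C_mul_charIdeal_le_sq p
    (Submodule.torsion_isTorsion (R := IwasawaAlgebra p) (M := X.X))
    (isTorsion_quotient_heegnerModule hB hH hyp D F X)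
    (finite_coinvariants_torsion_of_finrank_eq_one p hX1 hctl) hc hMC

/-- **`ℋ_∞ = Λ κ_∞` with `κ_∞ ≠ 0`** (Howard 2004, Thm. 3.3.7: "The `Λ`-module `𝐇` is free of rank
one, generated by `κ̃₁`"; here from the tree fact `Howard2004_heegnerModule_free`, a basis of the free
rank-one module `heegnerModule D F`). [cite: Howard2004HeegnerKolyvagin, Thm. 3.3.7] -/
theorem exists_heegnerModule_eq_span_singleton (hH : Howard2004_heegnerModule_free N W K p κ γ jbar)
    (hyp : HowardHypotheses N W K p κ γ)
    (D : (W.baseChange K).LambdaAdicSelmerData κ γ) (F : HeegnerFamily N W K κ jbar) :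
    ∃ g : D.S, g ≠ 0 ∧ heegnerModule D F = Submodule.span (IwasawaAlgebra p) {g} := by
  obtain ⟨hfree, hH1⟩ := hH hyp D F
  haveI := hfree
  haveI : Module.Finite (IwasawaAlgebra p) (heegnerModule D F) :=
    Module.finite_of_finrank_pos (by omega)
  let b := Module.basisUnique (Fin 1) hH1
  refine ⟨(b default : heegnerModule D F), ?_, ?_⟩
  · intro h0
    have h : (b default : heegnerModule D F) = 0 := by exact_mod_cast h0
    exact b.ne_zero default h
  · apply le_antisymm
    · intro x hx
      have hmem : (⟨x, hx⟩ : heegnerModule D F) ∈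
          Submodule.span (IwasawaAlgebra p) (Set.range b) := b.mem_span _
      rw [Set.range_unique] at hmem
      have h := Submodule.mem_map_of_mem (f := (heegnerModule D F).subtype) hmem
      rwa [Submodule.map_span, Set.image_singleton, Submodule.subtype_apply] at h
    · rw [Submodule.span_le, Set.singleton_subset_iff]
      exact (b default).2

/-- **`p^m κ_∞ ∉ (γ - 1) S` for every generator `κ_∞` of `ℋ_∞` and every `m`** — the image of the
`Λ`-adic Heegner class in `S_Γ = S/JS` is not `ℤ_p`-torsion (Wan, proof of Thm. 3.17: "In sum the
image `κ₁` of `κ₁^{Hg}` is not torsion"), under the hypotheses of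
`heegnerModuleIndex_eq_zero_of_rational_mainConjecture`: the index `ℓ_𝔭(S/Λκ_∞)` vanishes and `S`
is torsion-free (`IwasawaAlgebra.pow_smul_notMem_TSubmodule_of_lengthAt_eq_zero`).
[cite: YanZhu2024MainConjNonCM, Thm. 4.15 (proof, §4.6)]
[cite: Wan2021HeegnerPointKolyvaginSystem, Thm. 3.17 (proof, p. 10)]
[cite: Howard2004HeegnerKolyvagin, §1 Thm. B and Thm. 3.3.7] -/
theorem pow_smul_heegnerGenerator_notMem_TSubmodule
    (hB : Howard2004_thmB N W K p κ γ jbar) (hH : Howard2004_heegnerModule_free N W K p κ γ jbar)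
    (hyp : HowardHypotheses N W K p κ γ)
    (D : (W.baseChange K).LambdaAdicSelmerData κ γ) (F : HeegnerFamily N W K κ jbar)
    (X : (W.baseChange K).SelmerDualData κ γ)
    {c : ℤ_[p]} (hc : c ≠ 0)
    (hMC : Ideal.span {(PowerSeries.C c : IwasawaAlgebra p)} *
        Module.charIdeal (IwasawaAlgebra p) (Submodule.torsion (IwasawaAlgebra p) X.X) ≤
      heegnerCharIdeal D F ^ 2)
    (hctl : coinvariantsRank p X.X ≤ 1)
    {g : D.S} (hg : heegnerModule D F = Submodule.span (IwasawaAlgebra p) {g}) (m : ℕ) :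
    ((p : IwasawaAlgebra p) ^ m) • g ∉ TSubmodule p D.S := by
  obtain ⟨⟨hSfin, hStf, hS1⟩, -⟩ := hB hyp D F X
  obtain ⟨-, hH1⟩ := hH hyp D F
  -- `g ≠ 0`: otherwise `ℋ_∞ = 0` has rank `0 ≠ 1`
  have hg0 : g ≠ 0 := by
    intro h0
    rw [h0, Submodule.span_zero_singleton] at hg
    rw [hg, finrank_bot] at hH1
    exact zero_ne_one hH1
  have hidx := heegnerModuleIndex_eq_zero_of_rational_mainConjecture hB hH hyp D F X hc hMC hctl
  rw [heegnerModuleIndex_eq_lengthAt_primeT,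
    Module.lengthAt_eq_of_linearEquiv (Submodule.quotEquivOfEq _ _ hg) (primeT p)] at hidx
  exact pow_smul_notMem_TSubmodule_of_lengthAt_eq_zero p hg0 hidx m

/-- The same in `S_Γ = S/JS`: **`p^m • (κ_∞ mod JS) ≠ 0` for every `m`**.
[cite: YanZhu2024MainConjNonCM, Thm. 4.15 (proof, §4.6)]
[cite: Wan2021HeegnerPointKolyvaginSystem, Thm. 3.17 (proof, p. 10)] -/
theorem pow_smul_mkQ_heegnerGenerator_ne_zero
    (hB : Howard2004_thmB N W K p κ γ jbar) (hH : Howard2004_heegnerModule_free N W K p κ γ jbar)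
    (hyp : HowardHypotheses N W K p κ γ)
    (D : (W.baseChange K).LambdaAdicSelmerData κ γ) (F : HeegnerFamily N W K κ jbar)
    (X : (W.baseChange K).SelmerDualData κ γ)
    {c : ℤ_[p]} (hc : c ≠ 0)
    (hMC : Ideal.span {(PowerSeries.C c : IwasawaAlgebra p)} *
        Module.charIdeal (IwasawaAlgebra p) (Submodule.torsion (IwasawaAlgebra p) X.X) ≤
      heegnerCharIdeal D F ^ 2)
    (hctl : coinvariantsRank p X.X ≤ 1)
    {g : D.S} (hg : heegnerModule D F = Submodule.span (IwasawaAlgebra p) {g}) (m : ℕ) :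
    p ^ m • (Submodule.Quotient.mk g : coinvariants p D.S) ≠ 0 := by
  obtain ⟨⟨hSfin, hStf, hS1⟩, -⟩ := hB hyp D F X
  obtain ⟨-, hH1⟩ := hH hyp D F
  have hg0 : g ≠ 0 := by
    intro h0
    rw [h0, Submodule.span_zero_singleton] at hg
    rw [hg, finrank_bot] at hH1
    exact zero_ne_one hH1
  have hidx := heegnerModuleIndex_eq_zero_of_rational_mainConjecture hB hH hyp D F X hc hMC hctl
  rw [heegnerModuleIndex_eq_lengthAt_primeT,
    Module.lengthAt_eq_of_linearEquiv (Submodule.quotEquivOfEq _ _ hg) (primeT p)] at hidx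
  exact pow_smul_mkQ_ne_zero_of_lengthAt_eq_zero p hg0 hidx m

/-- **Specialisation ("and using Gross-Zagier formula").** If `sp : S/JS → H` is additive with
`p`-power-torsion kernel (an injection after `⊗ ℚ_p`: in the application the base projection
`pr_0 : S_Γ → S_p(E/K) ⊗ ℚ_p`, carrying `κ_∞` to a nonzero multiple of the Kummer image of the
Heegner point `y_K`), then `p^m • sp (κ_∞ mod JS) ≠ 0` for every `m` — "`y_K` is non-torsion", which
Gross–Zagier–Kolyvagin (tree fact `analyticRankEK_eq_one_iff_heegner_nonTorsion`) turns into
`ord_{s=1} L(E/K, s) = 1`. [cite: YanZhu2024MainConjNonCM, Thm. 4.15 (proof, §4.6)]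
[cite: Wan2021HeegnerPointKolyvaginSystem, Thm. 3.17 (proof, p. 10)] -/
theorem pow_smul_specialization_heegnerGenerator_ne_zero {H : Type*} [AddCommGroup H]
    (hB : Howard2004_thmB N W K p κ γ jbar) (hH : Howard2004_heegnerModule_free N W K p κ γ jbar)
    (hyp : HowardHypotheses N W K p κ γ)
    (D : (W.baseChange K).LambdaAdicSelmerData κ γ) (F : HeegnerFamily N W K κ jbar)
    (X : (W.baseChange K).SelmerDualData κ γ)
    {c : ℤ_[p]} (hc : c ≠ 0)
    (hMC : Ideal.span {(PowerSeries.C c : IwasawaAlgebra p)} *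
        Module.charIdeal (IwasawaAlgebra p) (Submodule.torsion (IwasawaAlgebra p) X.X) ≤
      heegnerCharIdeal D F ^ 2)
    (hctl : coinvariantsRank p X.X ≤ 1)
    {g : D.S} (hg : heegnerModule D F = Submodule.span (IwasawaAlgebra p) {g})
    (sp : coinvariants p D.S →+ H) (hsp : ∀ x, sp x = 0 → ∃ n : ℕ, p ^ n • x = 0) (m : ℕ) :
    p ^ m • sp (Submodule.Quotient.mk g) ≠ 0 := by
  intro h0
  rw [← map_nsmul] at h0
  obtain ⟨n, hn⟩ := hsp _ h0
  rw [← mul_nsmul', ← pow_add] at hn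
  exact pow_smul_mkQ_heegnerGenerator_ne_zero hB hH hyp D F X hc hMC hctl hg (n + m) hn

end Literature.NumberTheory.EllipticCurves

end
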